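import Summits.BirchSwinnertonDyer.BirchSwinnertonDyer.Theorems.ResidualThetaTransportAtTwoResidualSignedLambdaLowerCMAtTwoReciprocityLevelwise
import Summits.BirchSwinnertonDyer.BirchSwinnertonDyer.Theorems.ResidualThetaTransportAtTwoResidualSignedLambdaLowerCMAtTwoCosetFrameOdd
import Summits.BirchSwinnertonDyer.BirchSwinnertonDyer.Theorems.ThetaPartnerAtTwoSignedKatoUpToAtTwoLayerGlobalShapiro
import Literature.NumberTheory.EllipticCurves.CyclotomicLayerPairingOfFunMackey
import Literature.NumberTheory.GaloisRepresentations.ContinuousShapiroLiftRestrictHom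
import Literature.NumberTheory.EllipticCurves.IwasawaTwistModPShapiroCores
import Summits.BirchSwinnertonDyer.BirchSwinnertonDyer.Theorems.ResidualThetaTransportAtTwoResidualSignedLambdaLowerCMAtTwoAtTwoPlus
import HarnessLib

/-!
# The LEVELWISE (EH) of line `onepair` in the frame's indexing: at layer `n ≥ n_w` (`w ∈ S₀`) and level `2^K`,
# `⟨loc_v a, loc_v b⟩_{n,v} + Σ_{w ∈ S₀} Σ_{c ∈ Γ_ℚ/Γ_{n_w}} ⟨loc_w(c.out · a), loc_w(c.out · b)⟩_{n,w} = 0 ∈ ℤ/2^K`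
# for admissible classes `a, b ∈ H¹(Γ_n, A_ρ[2^K])` (crux RSL_g, stmt-BirchSwinnertonDyer-22608, split stub EH `stub_reciprocity`)

Route `ResidualThetaTransportAtTwo` (RTT), crux RSL_g `ResidualSignedLambdaLowerCMAtTwo`, line «onepair» (skeleton v3b), split stub EH; seat
`prover-bsd-wall-tp2-p2x-w3` g17 (`--supports`, closes nothing). THEOREMS ONLY (no definition, no named fact, no instance, no `sorry`).
BSD is not proved by any of this; RSL_g (22608) and K3 (20308) stay OPEN.

WHAT. **`levelwise_reciprocity_cosets`**: on the RSL_g habitat (`GoodSS W 2`, `Δ_W < 0`, congruent CM newform `g`, framed `ρ`, irreducible `ϖ`),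
for the cyclotomic `κ`, the place `v ∋ 2`, a finite set `S₀` of ODD places, a layer `n ≥ nfl w` for all `w ∈ S₀`, a level `2^K` with a pairing
datum `e` on `A_ρ[2^K]`, and two classes `a, b ∈ H¹(Γ_n, A_ρ[2^K])` dying on `Γ_n ⊓ I_𝔓` for every `𝔓 ∣ v' ∉ {v} ∪ S₀`:
`layerPairingH1Of … v n (loc a) (loc b) + ∑ w : ↥S₀, ∑ᶠ c : Cosets κ w, layerPairingH1Of … w n (loc (c.out · a)) (loc (c.out · b)) = 0`.
Proof = the pin-free core `ThetaTransport.sum_localInvariantMap_cupProduct_shapiroLift_cofreeTorsion_eq_zero` (p688154, real place silent by S-A)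
for `U = Γ_n`, `N = 2^K`, `P = (contPairingOfFun …).coindFin Γ_n`, `T = {v} ∪ S₀`, read place by place: ONE orbit at `v ∣ 2`
(`CyclotomicLayer.invAt_localization_cupProduct_shapiroLift_eq_of_surjective`, total ramification
`SignedKatoOffTwo.LayerPairing.forall_exists_inv_mul_mem_layerSubgroup`), the cosets `Γ_ℚ ⧸ Γ_{n_w}` with representatives `c.out` at `w ∈ S₀`
(`CyclotomicLayer.invAt_localization_cupProduct_shapiroLift_eq_sum` with the Mackey index datum `CosetFrame.bijective_cosets_out`, p697697).
This is EXACTLY the sum the pins of the split text EH evaluate to (`AtTwoPins.hc₂` + `OnePairPins.hlocd₂`/`hpair` at `v`; `AwayPins.hlocdS` at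
`(w, c)`), so EH follows by reading both sides at a common deep layer (`…ReciprocityKummer`, `…ReciprocityExhaustion`).

References: [MilneADT2006] Ch. I Thm. 4.10 (b); [NeukirchSchmidtWingberg2008] I §5 (1.5.6)–(1.5.7), I §6 (1.6.4), VIII §1; [Kobayashi2003] (8.23),
Thm. 7.3; [Brown1982] III §5 (5.6)(b); [Washington1997] §13.1.
-/

set_option autoImplicit false
-- the Theorems namespace of this sub repeats the summit name by design (D-0017 nested layout)
set_option linter.dupNamespace false

noncomputable section

open scoped Classical NumberField

namespace Summit.BirchSwinnertonDyer.BirchSwinnertonDyer.Theorems.ThetaTransport.Reciprocity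

open CategoryTheory Field NumberField IsDedekindDomain WeierstrassCurve
  Literature.NumberTheory.EllipticCurves Literature.NumberTheory.GaloisRepresentations
  Literature.NumberTheory.EllipticCurves.GreenbergSelmer Literature.NumberTheory.EllipticCurves.CyclotomicLayer
  Literature.NumberTheory.EllipticCurves.Rank1Residual Rat.HeightOneSpectrum
  Literature.NumberTheory.GaloisCohomology Literature.NumberTheory.GaloisRepresentations.DiscreteGaloisModule ZpExtension
  Summit.BirchSwinnertonDyer.BirchSwinnertonDyer.Theorems Summit.BirchSwinnertonDyer.BirchSwinnertonDyer.Theorems.OnePair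

/-- Off `{v} ∪ S₀` a place is not above `2` (so Kato's integrality `IwasawaH1DataCoeff.proj_mem`, stated for `ℓ_{v'} ≠ 2`, applies there).
[folklore] -/
theorem primesEquiv_ne_two_of_not_mem {v v' : HeightOneSpectrum (𝓞 ℚ)} (hv : ((2 : ℕ) : 𝓞 ℚ) ∈ v.asIdeal)
    (S₀ : Finset (HeightOneSpectrum (𝓞 ℚ))) (hv' : v' ∉ insert v S₀) : ((primesEquiv v' : Nat.Primes) : ℕ) ≠ 2 := by
  intro h
  apply hv'
  rw [Finset.mem_insert]
  left
  refine AtTwoPackage.eq_of_two_mem_asIdeal hv ?_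
  have h' := natCast_natGenerator_mem v'
  change natGenerator v' = 2 at h
  rwa [h] at h'

-- the core (p688154) states the cup product over `(ρ.coind U hU).toTopRep`, the Mackey lemmas over `coindFin ρ.toTopRep U` (defeq by `rfl`,
-- `DiscreteGaloisModule.toTopRep_coind`); unifying the two implicit-argument forms of `cupProduct` at `key` is slow
set_option maxHeartbeats 3000000 in
/-- **Levelwise (EH) in the frame's indexing.** On the RSL_g habitat, for the cyclotomic `κ`, `v ∋ 2`, odd `S₀`, `n ≥ n_w` (`w ∈ S₀`), a level
`2^K` with pairing datum `e` on `A_ρ[2^K]`, and admissible `a, b ∈ H¹(Γ_n, A_ρ[2^K])` (dying on `Γ_n ⊓ I_𝔓`, `𝔓 ∣ v' ∉ {v} ∪ S₀`):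
`⟨loc_v a, loc_v b⟩_{n,2^K,v} + Σ_{w ∈ S₀} Σ_{c ∈ Γ_ℚ ⧸ Γ_{n_w}} ⟨loc_w(c.out · a), loc_w(c.out · b)⟩_{n,2^K,w} = 0`.
[cite: MilneADT2006, Ch. I, Thm. 4.10 (b)] [cite: NeukirchSchmidtWingberg2008, I §5 (1.5.6)–(1.5.7), I §6 (1.6.4)] [cite: Kobayashi2003, (8.23) (p. 18)] -/
theorem levelwise_reciprocity_cosets (W : WeierstrassCurve ℚ) [W.IsElliptic] [W.IsGloballyMinimal] (hss : GoodSS W 2) (hΔ : W.Δ < 0)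
    {M : ℕ} [NeZero M] (g : CuspForm (CongruenceSubgroup.Gamma0 M) 2) (ι : ModularForms.coeffField g →+* PadicAlgCl 2)
    (hnew : ModularForms.IsNewform0 g)
    (hcong : ∀ ℓ : ℕ, ℓ.Prime → ¬ ℓ ∣ 2 * M * W.conductorNorm ℤ → ‖embCoeff g ι ℓ - (W.frobeniusTrace ℓ : PadicAlgCl 2)‖ < 1)
    (ρ : FramedGaloisRep ℚ ↥(padicCoeffIntegers (Set.range ι)) 2)
    (hρ : ∀ v : HeightOneSpectrum (𝓞 ℚ), ¬ natGenerator v ∣ 2 * M →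
      FramedGaloisRep.IsUnramifiedAt v ρ ∧ ∃ P : Polynomial ↥(padicCoeffIntegers (Set.range ι)),
        P.map (padicCoeffIntegers (Set.range ι)).subtype =
          Polynomial.X ^ 2 - Polynomial.C (embCoeff g ι (natGenerator v)) * Polynomial.X + Polynomial.C ((natGenerator v : ℕ) : PadicAlgCl 2) ∧
        FramedGaloisRep.HasFrobCharpolyAt v P ρ)
    (ϖ : ↥(padicCoeffIntegers (Set.range ι))) (hϖ : Irreducible ϖ)
    (κ : ZpExtension ℚ 2) (hκ : κ.IsCyclotomic) (v : HeightOneSpectrum (𝓞 ℚ)) (hv : ((2 : ℕ) : 𝓞 ℚ) ∈ v.asIdeal)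
    (S₀ : Finset (HeightOneSpectrum (𝓞 ℚ))) (hS₀2 : ∀ w ∈ S₀, ((2 : ℕ) : 𝓞 ℚ) ∉ w.asIdeal)
    (K n : ℕ) (hn : ∀ w ∈ S₀, nfl w ≤ n)
    (e : ↥(AddSubgroup.torsionBy (Cofree ρ ↥(padicCoeffField (Set.range ι))) ((2 ^ K : ℕ) : ℤ)) →
      ↥(AddSubgroup.torsionBy (Cofree ρ ↥(padicCoeffField (Set.range ι))) ((2 ^ K : ℕ) : ℤ)) → AlgebraicClosure ℚ)
    (hμ : ∀ x y, e x y ^ (2 ^ K) = 1) (hadd₁ : ∀ x₁ x₂ y, e (x₁ + x₂) y = e x₁ y * e x₂ y) (hadd₂ : ∀ x y₁ y₂, e x (y₁ + y₂) = e x y₁ * e x y₂)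
    (hgal : ∀ (σ : absoluteGaloisGroup ℚ) x y, σ • e x y =
      e (cofreeTorsionGaloisModule (Set.range ι) ρ ((2 ^ K : ℕ) : ℤ) σ x) (cofreeTorsionGaloisModule (Set.range ι) ρ ((2 ^ K : ℕ) : ℤ) σ y))
    (a b : H1 (cofreeTorsionGaloisModule (Set.range ι) ρ ((2 ^ K : ℕ) : ℤ)) (κ.layerSubgroup n))
    (ha : ∀ v' : HeightOneSpectrum (𝓞 ℚ), v' ∉ insert v S₀ → ∀ 𝔓 ∈ v'.primesAbove,
      resLe (cofreeTorsionGaloisModule (Set.range ι) ρ ((2 ^ K : ℕ) : ℤ)).toTopRep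
        (inf_le_left : κ.layerSubgroup n ⊓ 𝔓.inertia (absoluteGaloisGroup ℚ) ≤ κ.layerSubgroup n) 1 a = 0)
    (hb : ∀ v' : HeightOneSpectrum (𝓞 ℚ), v' ∉ insert v S₀ → ∀ 𝔓 ∈ v'.primesAbove,
      resLe (cofreeTorsionGaloisModule (Set.range ι) ρ ((2 ^ K : ℕ) : ℤ)).toTopRep
        (inf_le_left : κ.layerSubgroup n ⊓ 𝔓.inertia (absoluteGaloisGroup ℚ) ≤ κ.layerSubgroup n) 1 b = 0) :
    haveI : NeZero (2 ^ K) := ⟨pow_ne_zero K two_ne_zero⟩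
    layerPairingH1Of (cofreeTorsionGaloisModule (Set.range ι) ρ ((2 ^ K : ℕ) : ℤ)) (2 ^ K) e hμ hadd₁ hadd₂ hgal κ v n
        (layerLocOf (cofreeTorsionGaloisModule (Set.range ι) ρ ((2 ^ K : ℕ) : ℤ)) κ v n a)
        (layerLocOf (cofreeTorsionGaloisModule (Set.range ι) ρ ((2 ^ K : ℕ) : ℤ)) κ v n b) +
      ∑ w : ↥S₀, ∑ᶠ c : Cosets κ (w : HeightOneSpectrum (𝓞 ℚ)),
        layerPairingH1Of (cofreeTorsionGaloisModule (Set.range ι) ρ ((2 ^ K : ℕ) : ℤ)) (2 ^ K) e hμ hadd₁ hadd₂ hgal κ w n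
          (layerLocOf (cofreeTorsionGaloisModule (Set.range ι) ρ ((2 ^ K : ℕ) : ℤ)) κ w n
            (conjMap (cofreeTorsionGaloisModule (Set.range ι) ρ ((2 ^ K : ℕ) : ℤ)).toTopRep (κ.layerSubgroup n) c.out 1 a))
          (layerLocOf (cofreeTorsionGaloisModule (Set.range ι) ρ ((2 ^ K : ℕ) : ℤ)) κ w n
            (conjMap (cofreeTorsionGaloisModule (Set.range ι) ρ ((2 ^ K : ℕ) : ℤ)).toTopRep (κ.layerSubgroup n) c.out 1 b)) = 0 := by
  haveI : NeZero (2 ^ K) := ⟨pow_ne_zero K two_ne_zero⟩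
  haveI hF : ∀ m : ℕ, Fintype (absoluteGaloisGroup ℚ ⧸ κ.layerSubgroup m) := fun m ↦ κ.fintypeQuotientLayer m
  haveI : CompactSpace (absoluteGaloisGroup ℚ) := absoluteGaloisGroup_compactSpace ℚ
  haveI hC : ∀ w : HeightOneSpectrum (𝓞 ℚ), CompactSpace (absoluteGaloisGroup (w.adicCompletion ℚ)) :=
    fun w ↦ absoluteGaloisGroup_compactSpace _
  have hvS₀ : v ∉ S₀ := fun h ↦ hS₀2 v h hv
  -- (`have` then `obtain`: `rcases` on a composite term would generalize it over the large goal)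
  have hreps := exists_reps_one (G := absoluteGaloisGroup ℚ) (κ.layerSubgroup n)
  obtain ⟨s, hs, hs1⟩ := hreps
  -- the pin-free core on `T = {v} ∪ S₀`, for cocycles of `a`, `b`
  have ha' := oneCocycleClass_surjective (subgroupRep (cofreeTorsionGaloisModule (Set.range ι) ρ ((2 ^ K : ℕ) : ℤ)).toTopRep (κ.layerSubgroup n)) a
  have hb' := oneCocycleClass_surjective (subgroupRep (cofreeTorsionGaloisModule (Set.range ι) ρ ((2 ^ K : ℕ) : ℤ)).toTopRep (κ.layerSubgroup n)) b
  obtain ⟨ψ₁, rfl⟩ := ha'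
  obtain ⟨ψ₂, rfl⟩ := hb'
  have hcore := ThetaTransport.sum_localInvariantMap_cupProduct_shapiroLift_cofreeTorsion_eq_zero W hss hΔ g ι hnew hcong ρ hρ ϖ hϖ
    (κ.layerSubgroup n) (κ.isOpen_layerSubgroup n) hs hs1 (2 ^ K) ⟨K, rfl⟩
    ((contPairingOfFun (cofreeTorsionGaloisModule (Set.range ι) ρ ((2 ^ K : ℕ) : ℤ)) (2 ^ K) e hμ hadd₁ hadd₂ hgal).coindFin
      (κ.layerSubgroup n))
    (insert v S₀) ψ₁ ψ₂ ha hb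
  rw [Finset.sum_insert hvS₀] at hcore
  -- the term at `v`: ONE orbit (`2` is totally ramified in `ℚ_∞`)
  have hvterm : localInvariantMap ℚ (2 ^ K) v (galoisCohomology.localization (mu ℚ (2 ^ K)) (Sum.inr v) 2
      ((((contPairingOfFun (cofreeTorsionGaloisModule (Set.range ι) ρ ((2 ^ K : ℕ) : ℤ)) (2 ^ K) e hμ hadd₁ hadd₂ hgal).coindFin
          (κ.layerSubgroup n))).cupProduct
        (shapiroLift (cofreeTorsionGaloisModule (Set.range ι) ρ ((2 ^ K : ℕ) : ℤ)).toTopRep (κ.layerSubgroup n) (κ.isOpen_layerSubgroup n)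
          hs hs1 (oneCocycleClass _ ψ₁))
        (shapiroLift (cofreeTorsionGaloisModule (Set.range ι) ρ ((2 ^ K : ℕ) : ℤ)).toTopRep (κ.layerSubgroup n) (κ.isOpen_layerSubgroup n)
          hs hs1 (oneCocycleClass _ ψ₂)))) =
      layerPairingH1Of (cofreeTorsionGaloisModule (Set.range ι) ρ ((2 ^ K : ℕ) : ℤ)) (2 ^ K) e hμ hadd₁ hadd₂ hgal κ v n
        (layerLocOf (cofreeTorsionGaloisModule (Set.range ι) ρ ((2 ^ K : ℕ) : ℤ)) κ v n (oneCocycleClass _ ψ₁))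
        (layerLocOf (cofreeTorsionGaloisModule (Set.range ι) ρ ((2 ^ K : ℕ) : ℤ)) κ v n (oneCocycleClass _ ψ₂)) :=
    invAt_localization_cupProduct_shapiroLift_eq_of_surjective _ (2 ^ K) e hμ hadd₁ hadd₂ hgal κ v n hs hs1
      (quotientMapOfHom_surjective _ _ (SignedKatoOffTwo.LayerPairing.forall_exists_inv_mul_mem_layerSubgroup κ v hκ hv n)) _ _
  -- the terms at `w ∈ S₀`: the cosets `Γ_ℚ ⧸ Γ_{n_w}` with representatives `c.out`
  have hwterm : ∀ w ∈ S₀, localInvariantMap ℚ (2 ^ K) w (galoisCohomology.localization (mu ℚ (2 ^ K)) (Sum.inr w) 2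
      ((((contPairingOfFun (cofreeTorsionGaloisModule (Set.range ι) ρ ((2 ^ K : ℕ) : ℤ)) (2 ^ K) e hμ hadd₁ hadd₂ hgal).coindFin
          (κ.layerSubgroup n))).cupProduct
        (shapiroLift (cofreeTorsionGaloisModule (Set.range ι) ρ ((2 ^ K : ℕ) : ℤ)).toTopRep (κ.layerSubgroup n) (κ.isOpen_layerSubgroup n)
          hs hs1 (oneCocycleClass _ ψ₁))
        (shapiroLift (cofreeTorsionGaloisModule (Set.range ι) ρ ((2 ^ K : ℕ) : ℤ)).toTopRep (κ.layerSubgroup n) (κ.isOpen_layerSubgroup n)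
          hs hs1 (oneCocycleClass _ ψ₂)))) =
      ∑ c : Cosets κ w, layerPairingH1Of (cofreeTorsionGaloisModule (Set.range ι) ρ ((2 ^ K : ℕ) : ℤ)) (2 ^ K) e hμ hadd₁ hadd₂ hgal κ w n
        (layerLocOf (cofreeTorsionGaloisModule (Set.range ι) ρ ((2 ^ K : ℕ) : ℤ)) κ w n
          (conjMap (cofreeTorsionGaloisModule (Set.range ι) ρ ((2 ^ K : ℕ) : ℤ)).toTopRep (κ.layerSubgroup n) c.out 1 (oneCocycleClass _ ψ₁)))
        (layerLocOf (cofreeTorsionGaloisModule (Set.range ι) ρ ((2 ^ K : ℕ) : ℤ)) κ w n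
          (conjMap (cofreeTorsionGaloisModule (Set.range ι) ρ ((2 ^ K : ℕ) : ℤ)).toTopRep (κ.layerSubgroup n) c.out 1 (oneCocycleClass _ ψ₂))) :=
    fun w hw ↦ invAt_localization_cupProduct_shapiroLift_eq_sum _ (2 ^ K) e hμ hadd₁ hadd₂ hgal κ w n hs hs1
      (fun c : Cosets κ w ↦ (c.out : absoluteGaloisGroup ℚ)) (CosetFrame.bijective_cosets_out κ hκ w (hS₀2 w hw) (hn w hw)) _ _
  -- assemble WITHOUT rewriting inside the large terms: `A + B = X + Y = 0`
  have key := (congrArg₂ (· + ·) hvterm (Finset.sum_congr rfl hwterm)).symm.trans hcore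
  -- the frame's indexing: `∑ w : ↥S₀, ∑ᶠ c` is `∑ w ∈ S₀, ∑ c`
  have hfin : (∑ w : ↥S₀, ∑ᶠ c : Cosets κ (w : HeightOneSpectrum (𝓞 ℚ)),
        layerPairingH1Of (cofreeTorsionGaloisModule (Set.range ι) ρ ((2 ^ K : ℕ) : ℤ)) (2 ^ K) e hμ hadd₁ hadd₂ hgal κ w n
          (layerLocOf (cofreeTorsionGaloisModule (Set.range ι) ρ ((2 ^ K : ℕ) : ℤ)) κ w n
            (conjMap (cofreeTorsionGaloisModule (Set.range ι) ρ ((2 ^ K : ℕ) : ℤ)).toTopRep (κ.layerSubgroup n) c.out 1 (oneCocycleClass _ ψ₁)))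
          (layerLocOf (cofreeTorsionGaloisModule (Set.range ι) ρ ((2 ^ K : ℕ) : ℤ)) κ w n
            (conjMap (cofreeTorsionGaloisModule (Set.range ι) ρ ((2 ^ K : ℕ) : ℤ)).toTopRep (κ.layerSubgroup n) c.out 1 (oneCocycleClass _ ψ₂)))) =
      ∑ w ∈ S₀, ∑ c : Cosets κ w,
        layerPairingH1Of (cofreeTorsionGaloisModule (Set.range ι) ρ ((2 ^ K : ℕ) : ℤ)) (2 ^ K) e hμ hadd₁ hadd₂ hgal κ w n
          (layerLocOf (cofreeTorsionGaloisModule (Set.range ι) ρ ((2 ^ K : ℕ) : ℤ)) κ w n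
            (conjMap (cofreeTorsionGaloisModule (Set.range ι) ρ ((2 ^ K : ℕ) : ℤ)).toTopRep (κ.layerSubgroup n) c.out 1 (oneCocycleClass _ ψ₁)))
          (layerLocOf (cofreeTorsionGaloisModule (Set.range ι) ρ ((2 ^ K : ℕ) : ℤ)) κ w n
            (conjMap (cofreeTorsionGaloisModule (Set.range ι) ρ ((2 ^ K : ℕ) : ℤ)).toTopRep (κ.layerSubgroup n) c.out 1 (oneCocycleClass _ ψ₂))) :=
    (Finset.sum_congr rfl (fun w _ ↦ finsum_eq_sum_of_fintype _)).trans
      (Finset.sum_coe_sort S₀ (fun w : HeightOneSpectrum (𝓞 ℚ) ↦ ∑ c : Cosets κ w,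
        layerPairingH1Of (cofreeTorsionGaloisModule (Set.range ι) ρ ((2 ^ K : ℕ) : ℤ)) (2 ^ K) e hμ hadd₁ hadd₂ hgal κ w n
          (layerLocOf (cofreeTorsionGaloisModule (Set.range ι) ρ ((2 ^ K : ℕ) : ℤ)) κ w n
            (conjMap (cofreeTorsionGaloisModule (Set.range ι) ρ ((2 ^ K : ℕ) : ℤ)).toTopRep (κ.layerSubgroup n) c.out 1 (oneCocycleClass _ ψ₁)))
          (layerLocOf (cofreeTorsionGaloisModule (Set.range ι) ρ ((2 ^ K : ℕ) : ℤ)) κ w n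
            (conjMap (cofreeTorsionGaloisModule (Set.range ι) ρ ((2 ^ K : ℕ) : ℤ)).toTopRep (κ.layerSubgroup n) c.out 1 (oneCocycleClass _ ψ₂)))))
  rw [hfin]
  exact key

end Summit.BirchSwinnertonDyer.BirchSwinnertonDyer.Theorems.ThetaTransport.Reciprocity

end
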